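import Literature.MathematicalPhysics.QuantumLattice.EuclidLogPotentialSums
import Mathlib.Analysis.SpecialFunctions.Complex.Arg
import Mathlib.Analysis.SpecialFunctions.Pow.Real
import Mathlib.Analysis.SpecialFunctions.Log.Basic
import Mathlib.NumberTheory.Harmonic.Bounds
import HarnessLib

/-!
# The Kosterlitz–Thouless single-vortex energy–entropy argument, lattice-exact, for the plane rotator

Topic `Literature/Probability/LatticeModels` (cell `pub/hubbard-tc`, lane `p1`, ruling R76; the
provenance of the Nelson–Kosterlitz constant `(π/2)·J` of the cell's key K2).

J. M. Kosterlitz, D. J. Thouless, *Ordering, metastability and phase transitions in two-dimensional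
systems*, J. Phys. C **6** (1973) 1181 [KosterlitzThouless1973] (the original energy–entropy
estimate; not held, acq-13460); textbook form (held, cited below): I. Herbut,
*A Modern Approach to Critical Phenomena* (CUP 2007) §6.1, eqs. (6.4)–(6.7): the phase configuration
`θ(x) = q·α(x)` (`α` the polar angle, eq. (6.4)) is a vortex of charge `q`; "in the continuum
approximation" its energy in a system of linear size `R` is `H_v = π q² J ln(R/r₀)` (6.5); "the center
of a vortex may be placed at any of `∼ (R/r₀)²` sites", entropy `ΔS_v = ln (R/r₀)²`, so
`ΔF = π q² J ln(R/r₀) − 2T ln(R/r₀)` (6.6) "changes sign at `T_KT = π J/2`" (6.7) — the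
Nelson–Kosterlitz temperature with the bare stiffness `J` (`k_B = 1`).

This file makes the argument EXACT ON THE LATTICE, with no continuum approximation and no `ε`, for
the nearest-neighbour plane rotator (classical XY model) `H/J = ∑_{⟨xy⟩} (1 − cos(θ_x − θ_y))` with
free boundary condition on the box `Λ_R = [−R, R]² ∩ ℤ²`, and the unit vortex centred at the origin
site, `θ_x = arg(x₁ + i x₂)` (`vortexPhase`; Mathlib's `arg 0 = 0` fixes the immaterial core angle):

* `vortexPhase_axis` — unit winding: `θ = 0, π/2, π, −π/2` on `(1,0), (0,1), (−1,0), (0,−1)`.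
* `cos_vortexPhase_sub` — the bond cosine is the cosine of the angle between position vectors,
  `cos(θ_y − θ_x) = ⟨x,y⟩/(|x||y|)`; for the bond `x → x + e₁` (`x = (a,b)`, `n = |x|²`,
  `n' = |x+e₁|²`) this is `(n + a)/√(nn')` with `nn' = (n+a)² + b²`, whence the two-sided bond
  estimate `b²/(2n(√n+1)²) ≤ 1 − cos(θ_{x+e₁} − θ_x) ≤ b²/(4n²) + b²/(4n'²) + 1/(2n'²)`
  (`vortex_bond_e1_bounds`, `vortex_bond_e2_bounds`; leading term `sin²φ/(2r²) = ½|∂θ|²`).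
* `sum_sum_inv_normSq_ge` — the matching LOWER bound `Σ_{0<|u|_∞≤R} |u|⁻² ≥ 2π H(R) − 8` to the
  tree's Koma–Tasaki P2 sum `sum_sum_inv_normSq_le` (`≤ 2π H(ρ) + 8`, `EuclidLogPotentialSums`),
  by the row-by-row arctangent count (`∫_1^{R+1} dx/(a²+x²)`, `arctan((R+1)/a) ≥ π/2 − a/(R+1)`);
  the radial sums `Σ|x|⁻²`, `Σ|x|⁻⁴ ≤ 68`, `Σ|x|⁻³ ≤ 68` over the punctured box
  (`sum_box_inv_normSq_le/ge`, `…_sq_le`, `…_mul_sqrt_le`, the last two from the tree's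
  `sum_sum_secondary_le`).
* **`vortexEnergy_le_harmonic`**, **`harmonic_le_vortexEnergy`** — `π H(R) − 74 ≤ E_R ≤ π H(R+1) + 80`
  (`H` = harmonic numbers), hence **`abs_vortexEnergy_sub_pi_mul_log_le`**: `|E_R − π log R| ≤ 88`
  for every `R`, and `E_R/log R → π` (`tendsto_vortexEnergy_div_log`). The coefficient `π` of
  (6.5) is exact; `88` absorbs the core energy and every lattice correction.
* `card_box`, `log_card_box` — the positional entropy `log #Λ_R = 2 log(2R+1)`;
  `tendsto_log_card_box_div_log`: `log #Λ_R / log R → 2`.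
* **`tendsto_vortexFreeEnergy_div_log`** — for `F_R(T) = J·E_R − T·log #Λ_R` (`vortexFreeEnergy`):
  `F_R(T)/log R → π J − 2 T`; **`vortexFreeEnergy_eventually_neg`**: `T > (π/2) J ⇒ F_R(T) < 0`
  for all large `R` (free vortices proliferate); **`vortexFreeEnergy_eventually_pos`**:
  `T < (π/2) J ⇒ F_R(T) > 0` for all large `R`; `vortexFreeEnergy_slope_eq_zero_iff`: the slope
  vanishes iff `T = (π/2) J`. The threshold is EXACTLY the Nelson–Kosterlitz constant — the `2`
  (entropy dimension) and the `π` (vortex-energy prefactor) of Kosterlitz's recursion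
  `dy/dℓ = (2 − πK) y`, whose flow-level consequences (stability `K_R ≥ 2/π`, universal jump) are
  `KosterlitzRecursionFlow*.lean` / `KosterlitzUniversalJumpRobust.lean`.

Reading for the cell (number-neutral): K2's constant `(π/2)·J` (`= (π/4)·ρ_s` in the units
`J = ρ_s/2` of key K1b) has a kernel provenance in the comparison model — a free unit vortex in
`Λ_R` costs `π·J·log R ± C·J` (two-sided, lattice-exact) against `2·T·log R` of positional entropy.
WHAT THIS IS NOT: a statement about the XY Gibbs MEASURE or its transition temperature (it bounds no
`T_c` of any model; the identification of the transition with vortex unbinding stays RG-level), nor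
about vortex–antivortex pairs / screening (Herbut §6.2), other charges `q` (energy `∝ q²`), other
lattices or boundary conditions, or the harmonic (Villain) interaction.

## References

* J. M. Kosterlitz, D. J. Thouless, J. Phys. C 6 (1973) 1181–1203. [KosterlitzThouless1973]
* I. Herbut, *A Modern Approach to Critical Phenomena*, CUP 2007, §6.1 eqs. (6.4)–(6.7)
  [corpus `book:herbut2007` pp. 91–92]. [Herbut2007CriticalPhenomena]
* T. Koma, H. Tasaki, PRL 68 (1992) 3248, proof of eq. (13), P2 (the `2π log` lattice sum).
  [KomaTasakiPRL1992]

## Mathlib / tree search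

`Complex.cos_arg`, `Complex.sin_arg`, `Complex.norm_eq_sqrt_sq_add_sq`, `Complex.arg_I`,
`Complex.arg_neg_one`, `Complex.arg_neg_I`, `Real.cos_sub`, `Real.le_sqrt`, `Real.sq_sqrt`,
`Real.sqrt_le_left`, `Real.arctan_inv_of_pos`, `Real.le_tan`, `Real.tan_arctan`,
`integral_inv_one_add_sq`, `intervalIntegral.integral_comp_div`, `AntitoneOn.integral_le_sum_Ico`,
`intervalIntegral.integral_add_adjacent_intervals`, `harmonic_succ`, `log_add_one_le_harmonic`,
`harmonic_le_one_add_log`, `Int.card_Icc`, `Nat.cast_natAbs`, `Finset.sum_product`,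
`Finset.sum_image`, `Finset.sum_filter`, `Real.tendsto_log_atTop`, `Filter.Tendsto.div_atTop`,
`tendsto_of_tendsto_of_tendsto_of_le_of_le'`, `gt_mem_nhds`, `lt_mem_nhds`; tree:
`Literature.MathematicalPhysics.QuantumLattice.sum_sum_inv_normSq_le`, `sum_sum_secondary_le`
(`EuclidLogPotentialSums.lean`).
-/

noncomputable section

open Finset Filter
open scoped BigOperators Topology

namespace Literature.Probability.LatticeModels

namespace PlaneRotator

/-! ### The box, the vortex configuration, the free-boundary energy -/

/-- The square box `Λ_R = [-R, R]² ∩ ℤ²` of the square lattice, `(2R+1)²` sites. [folklore] -/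
def box (R : ℕ) : Finset (ℤ × ℤ) := (Icc (-(R : ℤ)) R) ×ˢ (Icc (-(R : ℤ)) R)

/-- The **unit-winding vortex** of the plane rotator centred at the origin: the site `x = (x₁, x₂)`
carries the angle `θ_x = arg(x₁ + i x₂) ∈ (-π, π]` (the polar angle of `x`; `θ_0 = 0` by `arg 0 = 0`,
the core spin's angle being immaterial). Kosterlitz–Thouless 1973; Herbut, *A Modern Approach to
Critical Phenomena* (CUP 2007) §6.1 eq. (6.4) (`θ(x) = q α`, `q = 1`).
[cite: Herbut2007CriticalPhenomena, §6.1 eq. (6.4)] -/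
def vortexPhase (x : ℤ × ℤ) : ℝ := Complex.arg ((x.1 : ℂ) + (x.2 : ℂ) * Complex.I)

/-- The nearest-neighbour **plane-rotator energy with free boundary condition** of an angle
configuration `θ` on the box `Λ_R`, in units of the coupling `J` and measured from the aligned state:
`H_R(θ)/J = ∑_{⟨x,y⟩ ⊂ Λ_R} (1 - cos(θ_y - θ_x))`, each nearest-neighbour bond of `Λ_R` counted once
(as the bond from `x` to `x + e₁` or `x + e₂`). [folklore] -/
def freeBoxEnergy (R : ℕ) (θ : ℤ × ℤ → ℝ) : ℝ :=
  ∑ x ∈ box R,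
    ((if x + (1, 0) ∈ box R then 1 - Real.cos (θ (x + (1, 0)) - θ x) else 0) +
      (if x + (0, 1) ∈ box R then 1 - Real.cos (θ (x + (0, 1)) - θ x) else 0))

/-- The energy `E_R = H_R(θ^vortex)/J` of the unit vortex in the box `Λ_R` (free boundary condition,
units of `J`). Kosterlitz–Thouless 1973; Herbut 2007 §6.1 eq. (6.5) (continuum approximation
`π ln(R/r₀)`). [cite: Herbut2007CriticalPhenomena, §6.1 eq. (6.5)] -/
def vortexEnergy (R : ℕ) : ℝ := freeBoxEnergy R vortexPhase

/-- The **Kosterlitz–Thouless free energy of a single free vortex** in `Λ_R` at temperature `T`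
(`k_B = 1`) and coupling `J`: energy `J · E_R` minus `T` times the positional entropy
`log #Λ_R = log (2R+1)²` (the vortex may be centred at any site of the box). Kosterlitz–Thouless 1973;
Herbut 2007 §6.1 eq. (6.6) (`ΔF = π q² Φ₀² ln(R/r₀) - 2 T ln(R/r₀)`).
[cite: Herbut2007CriticalPhenomena, §6.1 eq. (6.6)] -/
def vortexFreeEnergy (J T : ℝ) (R : ℕ) : ℝ :=
  J * vortexEnergy R - T * Real.log ((box R).card : ℝ)

/-- Squared Euclidean norm `|x|² = x₁² + x₂²` of a lattice point, as a real number. [folklore] -/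
def normSq (x : ℤ × ℤ) : ℝ := (x.1 : ℝ) ^ 2 + (x.2 : ℝ) ^ 2

/-- `0 ≤ |x|²`. [folklore] -/
private theorem normSq_nonneg (x : ℤ × ℤ) : 0 ≤ normSq x := by unfold normSq; positivity

/-- `0 < |x|²` for `x ≠ 0`. [folklore] -/
private theorem normSq_pos {x : ℤ × ℤ} (hx : x ≠ 0) : 0 < normSq x := by
  unfold normSq
  rcases x with ⟨a, b⟩
  have : a ≠ 0 ∨ b ≠ 0 := by
    by_contra h
    simp only [not_or, not_not] at h
    exact hx (by simp [h.1, h.2])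
  rcases this with ha | hb
  · have : (0:ℝ) < (a:ℝ) ^ 2 := by positivity
    positivity
  · have : (0:ℝ) < (b:ℝ) ^ 2 := by positivity
    positivity

/-- `1 ≤ |x|²` for a non-zero lattice point. [folklore] -/
private theorem one_le_normSq {x : ℤ × ℤ} (hx : x ≠ 0) : 1 ≤ normSq x := by
  unfold normSq
  rcases x with ⟨a, b⟩
  have : a ≠ 0 ∨ b ≠ 0 := by
    by_contra h
    simp only [not_or, not_not] at h
    exact hx (by simp [h.1, h.2])
  rcases this with ha | hb
  · have h1 : (1:ℤ) ≤ a ^ 2 := by nlinarith [Int.one_le_abs ha, sq_abs a]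
    have h1' : (1:ℝ) ≤ (a:ℝ) ^ 2 := by exact_mod_cast h1
    nlinarith [sq_nonneg (b:ℝ)]
  · have h1 : (1:ℤ) ≤ b ^ 2 := by nlinarith [Int.one_le_abs hb, sq_abs b]
    have h1' : (1:ℝ) ≤ (b:ℝ) ^ 2 := by exact_mod_cast h1
    nlinarith [sq_nonneg (a:ℝ)]

/-! ### The vortex phase: trigonometry -/

/-- The complex number `x₁ + i x₂` has norm `√(x₁² + x₂²)`. [folklore] -/
private theorem norm_coord_complex (x : ℤ × ℤ) :
    ‖((x.1 : ℂ) + (x.2 : ℂ) * Complex.I)‖ = Real.sqrt (normSq x) := by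
  rw [Complex.norm_eq_sqrt_sq_add_sq]
  simp [normSq]

/-- `x₁ + i x₂ ≠ 0` for `x ≠ 0`. [folklore] -/
private theorem coord_complex_ne_zero {x : ℤ × ℤ} (hx : x ≠ 0) :
    ((x.1 : ℂ) + (x.2 : ℂ) * Complex.I) ≠ 0 := by
  intro h
  have h1 := congrArg Complex.re h
  have h2 := congrArg Complex.im h
  simp at h1 h2
  exact hx (Prod.ext h1 h2)

/-- `cos θ_x = x₁/|x|` for `x ≠ 0`. [folklore] -/
private theorem cos_vortexPhase {x : ℤ × ℤ} (hx : x ≠ 0) :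
    Real.cos (vortexPhase x) = x.1 / Real.sqrt (normSq x) := by
  rw [vortexPhase, Complex.cos_arg (coord_complex_ne_zero hx), norm_coord_complex]
  simp

/-- `sin θ_x = x₂/|x|` (for `x = 0` both sides vanish). [folklore] -/
private theorem sin_vortexPhase (x : ℤ × ℤ) :
    Real.sin (vortexPhase x) = x.2 / Real.sqrt (normSq x) := by
  rw [vortexPhase, Complex.sin_arg, norm_coord_complex]
  simp

/-- The bond cosine of the vortex is the cosine of the angle between the position vectors:
`cos(θ_y - θ_x) = ⟨x, y⟩/(|x| |y|)` for `x, y ≠ 0` (the lattice form of `∇θ = q α̂/|x|`, Herbut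
(6.4)–(6.5)). [cite: Herbut2007CriticalPhenomena, §6.1 eq. (6.4)] -/
theorem cos_vortexPhase_sub {x y : ℤ × ℤ} (hx : x ≠ 0) (hy : y ≠ 0) :
    Real.cos (vortexPhase y - vortexPhase x) =
      ((x.1 : ℝ) * y.1 + (x.2 : ℝ) * y.2) / (Real.sqrt (normSq x) * Real.sqrt (normSq y)) := by
  rw [Real.cos_sub, cos_vortexPhase hx, cos_vortexPhase hy, sin_vortexPhase x, sin_vortexPhase y]
  have hx' : 0 < Real.sqrt (normSq x) := Real.sqrt_pos.2 (normSq_pos hx)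
  have hy' : 0 < Real.sqrt (normSq y) := Real.sqrt_pos.2 (normSq_pos hy)
  field_simp

/-- **Unit winding.** On the four axis neighbours of the core the vortex phase reads
`θ_{(1,0)} = 0`, `θ_{(0,1)} = π/2`, `θ_{(-1,0)} = π`, `θ_{(0,-1)} = -π/2`: going once around the origin
the phase advances by `π/2` per quarter turn (`-3π/2 ≡ π/2 (mod 2π)` across the cut), i.e. by `2π`
in total — winding number one. [cite: Herbut2007CriticalPhenomena, §6.1 eq. (6.4)] -/
theorem vortexPhase_axis :
    vortexPhase (1, 0) = 0 ∧ vortexPhase (0, 1) = Real.pi / 2 ∧ vortexPhase (-1, 0) = Real.pi ∧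
      vortexPhase (0, -1) = -(Real.pi / 2) := by
  refine ⟨?_, ?_, ?_, ?_⟩
  · simp [vortexPhase]
  · simp [vortexPhase, Complex.arg_I]
  · simp [vortexPhase, Complex.arg_neg_one]
  · simp [vortexPhase, Complex.arg_neg_I]

/-! ### One bond of the vortex: the exact cosine and its two-sided estimate -/

/-- Elementary: for `0 ≤ P ≤ s`, `0 < s`, the deficit `1 - P/s` lies between `(s² - P²)/(2s²)` and
`(s² - P²)/(2s²) + (s² - P²)²/(2s⁴)` (both differences are the manifestly signed
`(s - P)²/(2s²)` and `P(s - P)²(2s + P)/(2s⁴)`). [folklore] -/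
private theorem one_sub_div_mem_Icc {P s : ℝ} (hP : 0 ≤ P) (hPs : P ≤ s) (hs : 0 < s) :
    (s ^ 2 - P ^ 2) / (2 * s ^ 2) ≤ 1 - P / s ∧
      1 - P / s ≤ (s ^ 2 - P ^ 2) / (2 * s ^ 2) + (s ^ 2 - P ^ 2) ^ 2 / (2 * s ^ 4) := by
  have hs2 : 0 < s ^ 2 := by positivity
  have hs4 : 0 < s ^ 4 := by positivity
  constructor
  · rw [div_le_iff₀ (by positivity), show (1 - P / s) * (2 * s ^ 2) = 2 * s * (s - P) by
      field_simp]
    nlinarith [sq_nonneg (s - P)]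
  · rw [div_add_div _ _ (by positivity) (by positivity), le_div_iff₀ (by positivity),
      show (1 - P / s) * (2 * s ^ 2 * (2 * s ^ 4)) = 4 * s ^ 5 * (s - P) by field_simp; ring]
    have h1 : 0 ≤ s - P := sub_nonneg.2 hPs
    have key : 0 ≤ P * (s - P) ^ 2 * (2 * s + P) := by positivity
    nlinarith [key, mul_nonneg h1 hs4.le, mul_nonneg (mul_nonneg h1 hP) hs2.le]

/-- The abstract bond estimate. If `n ≥ 1`, `n' > 0` are the squared norms of the two ends of a
bond, `n n' = P² + β` with `P ≥ 0`, `0 ≤ β ≤ n`, and `n' ≤ (√n + 1)²`, then the bond energy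
`1 - P/√(n n')` satisfies `β/(2n(√n+1)²) ≤ 1 - P/√(nn') ≤ β/(4n²) + β/(4n'²) + 1/(2n'²)`.
[folklore] -/
private theorem bond_energy_bounds {n n' P β : ℝ} (hn : 1 ≤ n) (hn' : 0 < n') (hP : 0 ≤ P) (hβ : 0 ≤ β)
    (hβn : β ≤ n) (hQ : n * n' = P ^ 2 + β) (hn'le : n' ≤ (Real.sqrt n + 1) ^ 2) :
    β / (2 * n * (Real.sqrt n + 1) ^ 2) ≤ 1 - P / Real.sqrt (n * n') ∧
      1 - P / Real.sqrt (n * n') ≤ β / (4 * n ^ 2) + β / (4 * n' ^ 2) + 1 / (2 * n' ^ 2) := by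
  have hn0 : 0 < n := by linarith
  have hQpos : 0 < n * n' := mul_pos hn0 hn'
  set s := Real.sqrt (n * n') with hs_def
  have hs : 0 < s := Real.sqrt_pos.2 hQpos
  have hs2 : s ^ 2 = n * n' := Real.sq_sqrt hQpos.le
  have hPs : P ≤ s := by
    rw [hs_def, Real.le_sqrt hP hQpos.le, hQ]
    linarith
  have hβ' : s ^ 2 - P ^ 2 = β := by rw [hs2, hQ]; ring
  obtain ⟨hlo, hhi⟩ := one_sub_div_mem_Icc hP hPs hs
  rw [hβ'] at hlo hhi
  have hsq1 : 0 < Real.sqrt n + 1 := by positivity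
  constructor
  · -- lower: `β/(2 n (√n+1)²) ≤ β/(2 s²)` since `s² = n n' ≤ n (√n+1)²`
    refine le_trans ?_ hlo
    rw [hs2]
    apply div_le_div_of_nonneg_left hβ (by positivity)
    have := mul_le_mul_of_nonneg_left hn'le hn0.le
    nlinarith
  · -- upper: `β/(2s²) + β²/(2s⁴) ≤ β/(4n²) + β/(4n'²) + 1/(2n'²)`
    refine hhi.trans ?_
    rw [show s ^ 4 = (s ^ 2) ^ 2 by ring, hs2]
    have hamgm : β / (2 * (n * n')) ≤ β / (4 * n ^ 2) + β / (4 * n' ^ 2) := by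
      rw [div_add_div _ _ (by positivity) (by positivity), div_le_div_iff₀ (by positivity)
        (by positivity)]
      have h0 : 0 ≤ β * (n - n') ^ 2 := by positivity
      nlinarith [h0, mul_pos hn0 hn', sq_nonneg n, sq_nonneg n']
    have hquart : β ^ 2 / (2 * (n * n') ^ 2) ≤ 1 / (2 * n' ^ 2) := by
      rw [div_le_div_iff₀ (by positivity) (by positivity)]
      have hb2 : β ^ 2 ≤ n ^ 2 := pow_le_pow_left₀ hβ hβn 2
      nlinarith [hb2, sq_nonneg n']
    linarith

/-- Squared norm of the right neighbour: `|x + e₁|² = |x|² + 2x₁ + 1`. [folklore] -/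
private theorem normSq_add_e1 (x : ℤ × ℤ) : normSq (x + (1, 0)) = normSq x + 2 * x.1 + 1 := by
  simp only [normSq, Prod.fst_add, Prod.snd_add, Int.cast_add, Int.cast_one, add_zero]
  ring

/-- Squared norm of the upper neighbour: `|x + e₂|² = |x|² + 2x₂ + 1`. [folklore] -/
private theorem normSq_add_e2 (x : ℤ × ℤ) : normSq (x + (0, 1)) = normSq x + 2 * x.2 + 1 := by
  simp only [normSq, Prod.fst_add, Prod.snd_add, Int.cast_add, Int.cast_one, add_zero]
  ring

/-- An integer coordinate is at most the norm: `x₁ ≤ √(x₁² + x₂²)`. [folklore] -/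
private theorem fst_le_sqrt_normSq (x : ℤ × ℤ) : (x.1 : ℝ) ≤ Real.sqrt (normSq x) := by
  rw [normSq]
  calc (x.1 : ℝ) ≤ |(x.1 : ℝ)| := le_abs_self _
    _ = Real.sqrt ((x.1 : ℝ) ^ 2) := (Real.sqrt_sq_eq_abs _).symm
    _ ≤ Real.sqrt ((x.1 : ℝ) ^ 2 + (x.2 : ℝ) ^ 2) :=
        Real.sqrt_le_sqrt (by nlinarith [sq_nonneg (x.2 : ℝ)])

/-- `x₂ ≤ √(x₁² + x₂²)`. [folklore] -/
private theorem snd_le_sqrt_normSq (x : ℤ × ℤ) : (x.2 : ℝ) ≤ Real.sqrt (normSq x) := by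
  have h := fst_le_sqrt_normSq (x.2, x.1)
  simp only [normSq] at h ⊢
  rw [add_comm]
  exact h

/-- For an integer `a`, `0 ≤ a² + a`. [folklore] -/
private theorem sq_add_self_nonneg (a : ℤ) : (0 : ℝ) ≤ (a : ℝ) ^ 2 + a := by
  have h : (0 : ℤ) ≤ a ^ 2 + a := by nlinarith [sq_nonneg a, sq_nonneg (a + 1)]
  exact_mod_cast h

/-- **The horizontal bond of the vortex.** For `x ≠ 0` with `x + e₁ ≠ 0`, writing `n = |x|²`,
`n' = |x + e₁|²`, the bond energy `1 - cos(θ_{x+e₁} - θ_x) = 1 - (n + x₁)/√(n n')` (exactly) obeys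
`x₂²/(2n(√n+1)²) ≤ 1 - cos(θ_{x+e₁} - θ_x) ≤ x₂²/(4n²) + x₂²/(4n'²) + 1/(2n'²)`: the leading term
`x₂²/(2|x|⁴) = sin²φ/(2r²)` is the continuum `½|∂_1 θ|²`.
[cite: Herbut2007CriticalPhenomena, §6.1 eq. (6.5)] -/
theorem vortex_bond_e1_bounds {x : ℤ × ℤ} (hx : x ≠ 0) (hx' : x + (1, 0) ≠ 0) :
    (x.2 : ℝ) ^ 2 / (2 * normSq x * (Real.sqrt (normSq x) + 1) ^ 2) ≤
        1 - Real.cos (vortexPhase (x + (1, 0)) - vortexPhase x) ∧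
      1 - Real.cos (vortexPhase (x + (1, 0)) - vortexPhase x) ≤
        (x.2 : ℝ) ^ 2 / (4 * normSq x ^ 2) + (x.2 : ℝ) ^ 2 / (4 * normSq (x + (1, 0)) ^ 2) +
          1 / (2 * normSq (x + (1, 0)) ^ 2) := by
  have hcos : Real.cos (vortexPhase (x + (1, 0)) - vortexPhase x) =
      (normSq x + x.1) / Real.sqrt (normSq x * normSq (x + (1, 0))) := by
    rw [cos_vortexPhase_sub hx hx', Real.sqrt_mul (normSq_nonneg x)]
    congr 1
    simp only [normSq, Prod.fst_add, Prod.snd_add, Int.cast_add, Int.cast_one, add_zero]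
    ring
  rw [hcos]
  refine bond_energy_bounds (one_le_normSq hx) (normSq_pos hx') ?_ (sq_nonneg _) ?_ ?_ ?_
  · have := sq_add_self_nonneg x.1
    simp only [normSq]; nlinarith [sq_nonneg (x.2 : ℝ)]
  · simp only [normSq]; nlinarith [sq_nonneg (x.1 : ℝ)]
  · rw [normSq_add_e1]; simp only [normSq]; ring
  · rw [normSq_add_e1]
    have h1 := fst_le_sqrt_normSq x
    have h2 : Real.sqrt (normSq x) ^ 2 = normSq x := Real.sq_sqrt (normSq_nonneg x)
    nlinarith

/-- **The vertical bond of the vortex** (the same with the coordinates exchanged):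
`x₁²/(2n(√n+1)²) ≤ 1 - cos(θ_{x+e₂} - θ_x) ≤ x₁²/(4n²) + x₁²/(4n'²) + 1/(2n'²)`, `n' = |x + e₂|²`.
[cite: Herbut2007CriticalPhenomena, §6.1 eq. (6.5)] -/
theorem vortex_bond_e2_bounds {x : ℤ × ℤ} (hx : x ≠ 0) (hx' : x + (0, 1) ≠ 0) :
    (x.1 : ℝ) ^ 2 / (2 * normSq x * (Real.sqrt (normSq x) + 1) ^ 2) ≤
        1 - Real.cos (vortexPhase (x + (0, 1)) - vortexPhase x) ∧
      1 - Real.cos (vortexPhase (x + (0, 1)) - vortexPhase x) ≤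
        (x.1 : ℝ) ^ 2 / (4 * normSq x ^ 2) + (x.1 : ℝ) ^ 2 / (4 * normSq (x + (0, 1)) ^ 2) +
          1 / (2 * normSq (x + (0, 1)) ^ 2) := by
  have hcos : Real.cos (vortexPhase (x + (0, 1)) - vortexPhase x) =
      (normSq x + x.2) / Real.sqrt (normSq x * normSq (x + (0, 1))) := by
    rw [cos_vortexPhase_sub hx hx', Real.sqrt_mul (normSq_nonneg x)]
    congr 1
    simp only [normSq, Prod.fst_add, Prod.snd_add, Int.cast_add, Int.cast_one, add_zero]
    ring
  rw [hcos]
  refine bond_energy_bounds (one_le_normSq hx) (normSq_pos hx') ?_ (sq_nonneg _) ?_ ?_ ?_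
  · have := sq_add_self_nonneg x.2
    simp only [normSq]; nlinarith [sq_nonneg (x.1 : ℝ)]
  · simp only [normSq]; nlinarith [sq_nonneg (x.2 : ℝ)]
  · rw [normSq_add_e2]; simp only [normSq]; ring
  · rw [normSq_add_e2]
    have h1 := snd_le_sqrt_normSq x
    have h2 : Real.sqrt (normSq x) ^ 2 = normSq x := Real.sq_sqrt (normSq_nonneg x)
    nlinarith

/-- Every bond energy lies in `[0, 2]`. [folklore] -/
private theorem one_sub_cos_mem (t : ℝ) : 0 ≤ 1 - Real.cos t ∧ 1 - Real.cos t ≤ 2 := by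
  constructor <;> nlinarith [Real.cos_le_one t, Real.neg_one_le_cos t]

/-! ### Lattice sums I: from the box `[-R, R]²` to the quadrant form of `EuclidLogPotentialSums` -/

/-- Folding `[-R, R] ∩ ℤ` onto `{0, …, R}` by `a ↦ |a|`: the origin once, every other value twice.
[folklore] -/
private theorem sum_Icc_neg_natAbs (R : ℕ) (g : ℕ → ℝ) :
    ∑ a ∈ Icc (-(R : ℤ)) R, g a.natAbs =
      ∑ k ∈ range (R + 1), (if k = 0 then (1:ℝ) else 2) * g k := by
  induction R with
  | zero => simp
  | succ R ih =>
      have hset : Icc (-((R + 1 : ℕ) : ℤ)) ((R + 1 : ℕ) : ℤ) =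
          insert (-((R : ℤ) + 1)) (insert ((R : ℤ) + 1) (Icc (-(R : ℤ)) R)) := by
        ext x
        simp only [mem_Icc, mem_insert, Nat.cast_add, Nat.cast_one]
        omega
      have h1 : ((R : ℤ) + 1) ∉ Icc (-(R : ℤ)) R := by simp
      have h2 : (-((R : ℤ) + 1)) ∉ insert ((R : ℤ) + 1) (Icc (-(R : ℤ)) R) := by
        simp only [mem_insert, mem_Icc]; omega
      rw [hset, sum_insert h2, sum_insert h1, ih, sum_range_succ _ (R + 1)]
      have e1 : (-((R : ℤ) + 1)).natAbs = R + 1 := by omega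
      have e2 : ((R : ℤ) + 1).natAbs = R + 1 := by omega
      rw [e1, e2, if_neg (Nat.succ_ne_zero R)]
      ring

/-- Folding the box `Λ_R` onto the quadrant `[0, R]²` with the `ℤ²`-multiplicities `μ_0 = 1`,
`μ_k = 2` of `EuclidLogPotentialSums`. [folklore] -/
private theorem sum_box_natAbs (R : ℕ) (F : ℕ → ℕ → ℝ) :
    ∑ x ∈ box R, F x.1.natAbs x.2.natAbs =
      ∑ a ∈ range (R + 1), ∑ b ∈ range (R + 1),
        (if a = 0 then (1:ℝ) else 2) * (if b = 0 then (1:ℝ) else 2) * F a b := by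
  rw [box, sum_product]
  have h1 : ∀ a : ℤ, ∑ b ∈ Icc (-(R : ℤ)) R, F a.natAbs b.natAbs =
      ∑ k ∈ range (R + 1), (if k = 0 then (1:ℝ) else 2) * F a.natAbs k :=
    fun a => sum_Icc_neg_natAbs R (F a.natAbs)
  have h2 : ∑ a ∈ Icc (-(R : ℤ)) R, ∑ k ∈ range (R + 1), (if k = 0 then (1:ℝ) else 2) * F a.natAbs k =
      ∑ j ∈ range (R + 1), (if j = 0 then (1:ℝ) else 2) *
        ∑ k ∈ range (R + 1), (if k = 0 then (1:ℝ) else 2) * F j k :=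
    sum_Icc_neg_natAbs R (fun j => ∑ k ∈ range (R + 1), (if k = 0 then (1:ℝ) else 2) * F j k)
  rw [sum_congr rfl fun a _ => h1 a, h2]
  refine sum_congr rfl fun a _ => ?_
  rw [mul_sum]
  refine sum_congr rfl fun b _ => ?_
  ring

/-- A radial sum over the punctured box in quadrant form:
`∑_{x ∈ Λ_R, x ≠ 0} φ(|x|²) = ∑_{a,b ≤ R, (a,b) ≠ 0} μ_a μ_b φ(a² + b²)`. [folklore] -/
private theorem sum_box_radial_eq (R : ℕ) (φ : ℝ → ℝ) :
    ∑ x ∈ box R, (if x = 0 then 0 else φ (normSq x)) =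
      ∑ a ∈ range (R + 1), ∑ b ∈ range (R + 1),
        (if a = 0 ∧ b = 0 then (0:ℝ) else
          (if a = 0 then (1:ℝ) else 2) * (if b = 0 then (1:ℝ) else 2) *
            φ (((a : ℝ)) ^ 2 + ((b : ℝ)) ^ 2)) := by
  have key : ∀ x : ℤ × ℤ, (if x = 0 then 0 else φ (normSq x)) =
      (fun a b : ℕ => if a = 0 ∧ b = 0 then (0:ℝ) else φ ((a : ℝ) ^ 2 + (b : ℝ) ^ 2))
        x.1.natAbs x.2.natAbs := by
    intro x
    have hx : x = 0 ↔ x.1.natAbs = 0 ∧ x.2.natAbs = 0 := by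
      rw [Int.natAbs_eq_zero, Int.natAbs_eq_zero, Prod.ext_iff]; rfl
    have hn : normSq x = ((x.1.natAbs : ℕ) : ℝ) ^ 2 + ((x.2.natAbs : ℕ) : ℝ) ^ 2 := by
      rw [normSq, Nat.cast_natAbs, Nat.cast_natAbs, Int.cast_abs, Int.cast_abs, sq_abs, sq_abs]
    simp only [hx, hn]
  rw [sum_congr rfl fun x _ => key x,
    sum_box_natAbs R (fun a b : ℕ => if a = 0 ∧ b = 0 then (0:ℝ) else φ ((a : ℝ) ^ 2 + (b : ℝ) ^ 2))]
  refine sum_congr rfl fun a _ => sum_congr rfl fun b _ => ?_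
  split_ifs <;> ring

/-! ### Lattice sums II: the lower bound `∑_{0 < |u|_∞ ≤ R} |u|⁻² ≥ 2π H(R) - 8` -/

/-- `arctan y ≤ y` for `y ≥ 0`. [folklore] -/
private theorem arctan_le_self_of_nonneg {y : ℝ} (hy : 0 ≤ y) : Real.arctan y ≤ y := by
  have h0 : 0 ≤ Real.arctan y := Real.arctan_nonneg.2 hy
  have h1 : Real.arctan y < Real.pi / 2 := Real.arctan_lt_pi_div_two y
  calc Real.arctan y ≤ Real.tan (Real.arctan y) := Real.le_tan h0 h1
    _ = y := Real.tan_arctan y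

/-- `∫_0^B dx/(a² + x²) = arctan(B/a)/a` for `a > 0`. [folklore] -/
private theorem integral_inv_sq_add_sq {a : ℝ} (ha : 0 < a) (B : ℝ) :
    ∫ x in (0:ℝ)..B, (a ^ 2 + x ^ 2)⁻¹ = Real.arctan (B / a) / a := by
  have h1 : (fun x : ℝ => (a ^ 2 + x ^ 2)⁻¹) = fun x => (a ^ 2)⁻¹ * (1 + (x / a) ^ 2)⁻¹ := by
    funext x
    rw [← mul_inv]
    congr 1
    rw [div_pow, mul_add, mul_one, mul_div_cancel₀ _ (pow_ne_zero 2 ha.ne')]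
  rw [h1, intervalIntegral.integral_const_mul,
    intervalIntegral.integral_comp_div (fun x : ℝ => (1 + x ^ 2)⁻¹) ha.ne', zero_div,
    integral_inv_one_add_sq, Real.arctan_zero, sub_zero, smul_eq_mul]
  field_simp

/-- One row of the quadrant, from below: for `a ≥ 1`,
`∑_{b ≤ R} μ_b/(a² + b²) ≥ π/a - 2/(R+1) - 1/a²` (integral test on the decreasing `x ↦ 1/(a²+x²)`
over `[1, R+1]`, `arctan((R+1)/a) = π/2 - arctan(a/(R+1)) ≥ π/2 - a/(R+1)`). [folklore] -/
private theorem row_sum_inv_normSq_ge (a R : ℕ) (ha : 1 ≤ a) :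
    Real.pi / a - 2 / ((R : ℝ) + 1) - ((a : ℝ) ^ 2)⁻¹ ≤
      ∑ b ∈ range (R + 1), (if b = 0 then (1:ℝ) else 2) * (((a : ℝ) ^ 2 + (b : ℝ) ^ 2)⁻¹) := by
  have ha0 : (0 : ℝ) < a := by exact_mod_cast ha
  have hR0 : (0 : ℝ) < (R : ℝ) + 1 := by positivity
  set f : ℝ → ℝ := fun x => ((a : ℝ) ^ 2 + x ^ 2)⁻¹ with hf
  -- split off `b = 0`
  rw [range_eq_Ico, sum_eq_sum_Ico_succ_bot (Nat.succ_pos R)]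
  simp only [if_true, Nat.cast_zero, one_mul]
  have e0 : ((a : ℝ) ^ 2 + (0 : ℝ) ^ 2)⁻¹ = ((a : ℝ) ^ 2)⁻¹ := by norm_num
  rw [e0]
  have hrest : ∑ b ∈ Ico 1 (R + 1), (if b = 0 then (1:ℝ) else 2) * (((a : ℝ) ^ 2 + (b : ℝ) ^ 2)⁻¹) =
      2 * ∑ b ∈ Ico 1 (R + 1), f b := by
    rw [mul_sum]
    refine sum_congr rfl fun b hb => ?_
    rw [mem_Ico] at hb
    rw [if_neg (by omega)]
  rw [hrest]
  -- integral test on `[1, R+1]`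
  have hanti : AntitoneOn f (Set.Icc ((1:ℕ):ℝ) ((R+1:ℕ):ℝ)) := by
    intro x hx y _ hxy
    have hx0 : 0 ≤ x := le_trans (by norm_num) hx.1
    have hxy2 : x ^ 2 ≤ y ^ 2 := by nlinarith [mul_nonneg hx0 (sub_nonneg.2 hxy)]
    exact inv_anti₀ (by positivity) (by linarith)
  have hint : ∫ x in ((1:ℕ):ℝ)..((R+1:ℕ):ℝ), f x ≤ ∑ b ∈ Ico 1 (R + 1), f b :=
    hanti.integral_le_sum_Ico (by omega)
  -- evaluate / bound the integral
  have hcont : Continuous f := by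
    refine Continuous.inv₀ (by fun_prop) fun x => ?_
    positivity
  have hsplit : ∫ x in (0:ℝ)..((R:ℝ)+1), f x =
      (∫ x in (0:ℝ)..1, f x) + ∫ x in (1:ℝ)..((R:ℝ)+1), f x :=
    (intervalIntegral.integral_add_adjacent_intervals (hcont.intervalIntegrable _ _)
      (hcont.intervalIntegrable _ _)).symm
  have h01 : ∫ x in (0:ℝ)..1, f x ≤ ((a : ℝ) ^ 2)⁻¹ := by
    have hb : ∫ x in (0:ℝ)..1, f x ≤ ∫ _ in (0:ℝ)..1, ((a : ℝ) ^ 2)⁻¹ := by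
      refine intervalIntegral.integral_mono_on zero_le_one (hcont.intervalIntegrable _ _)
        intervalIntegrable_const fun x _ => ?_
      exact inv_anti₀ (by positivity) (by nlinarith [sq_nonneg x])
    simpa using hb
  have htot : ∫ x in (0:ℝ)..((R:ℝ)+1), f x = Real.arctan (((R:ℝ) + 1) / a) / a :=
    integral_inv_sq_add_sq ha0 _
  have harc : Real.pi / 2 - (a : ℝ) / ((R:ℝ) + 1) ≤ Real.arctan (((R:ℝ) + 1) / a) := by
    rw [show ((R:ℝ) + 1) / a = ((a:ℝ) / ((R:ℝ) + 1))⁻¹ by rw [inv_div],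
      Real.arctan_inv_of_pos (by positivity)]
    linarith [arctan_le_self_of_nonneg (show (0:ℝ) ≤ (a:ℝ) / ((R:ℝ)+1) by positivity)]
  have hint' : Real.arctan (((R:ℝ) + 1) / a) / a - ((a : ℝ) ^ 2)⁻¹ ≤ ∑ b ∈ Ico 1 (R + 1), f b := by
    have : ∫ x in (1:ℝ)..((R:ℝ)+1), f x ≤ ∑ b ∈ Ico 1 (R + 1), f b := by
      simpa [Nat.cast_add, Nat.cast_one] using hint
    linarith
  have hdiv : (Real.pi / 2 - (a : ℝ) / ((R:ℝ) + 1)) / a ≤ Real.arctan (((R:ℝ) + 1) / a) / a :=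
    div_le_div_of_nonneg_right harc ha0.le
  have hexp : (Real.pi / 2 - (a : ℝ) / ((R:ℝ) + 1)) / a = Real.pi / (2 * a) - 1 / ((R:ℝ) + 1) := by
    field_simp
  rw [hexp] at hdiv
  have e1 : Real.pi / a = 2 * (Real.pi / (2 * a)) := by field_simp
  have e2 : (2:ℝ) / ((R:ℝ) + 1) = 2 * (1 / ((R:ℝ) + 1)) := by ring
  rw [e1, e2]
  linarith [hdiv, hint']

/-- `Σ_{j<B} 1/(j+1)² ≤ 2` (telescoping against `1/(j(j+1))`; as in `EuclidLogPotentialSums`).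
[folklore] -/
private theorem sum_inv_succ_sq_le_two (B : ℕ) :
    ∑ j ∈ range B, ((((j : ℝ) + 1) ^ 2)⁻¹) ≤ 1 + 1 := by
  set g : ℕ → ℝ := fun j => if j = 0 then 2 else ((j : ℝ))⁻¹ with hg
  have hterm : ∀ j : ℕ, ((((j : ℝ) + 1) ^ 2)⁻¹) ≤ g j - g (j + 1) := by
    intro j
    rcases Nat.eq_zero_or_pos j with rfl | hj
    · simp [hg]
      norm_num
    · have hj0 : (0 : ℝ) < j := by exact_mod_cast hj
      have hne : j ≠ 0 := by omega
      simp only [hg, if_neg hne, if_neg (Nat.succ_ne_zero j), Nat.cast_succ]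
      rw [show ((j : ℝ))⁻¹ - ((j : ℝ) + 1)⁻¹ = ((j : ℝ) * ((j : ℝ) + 1))⁻¹ by
        field_simp; ring]
      exact inv_anti₀ (by positivity) (by nlinarith)
  have hgB : 0 ≤ g B := by
    simp only [hg]
    split_ifs
    · norm_num
    · positivity
  calc ∑ j ∈ range B, ((((j : ℝ) + 1) ^ 2)⁻¹) ≤ ∑ j ∈ range B, (g j - g (j + 1)) :=
        sum_le_sum fun j _ => hterm j
    _ = g 0 - g B := sum_range_sub' g B
    _ ≤ 1 + 1 := by simp only [hg, if_pos rfl]; linarith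

/-- `H(B) = Σ_{j<B} 1/(j+1)` over `ℝ`. [folklore] -/
private theorem harmonic_eq_sum_range_inv_succ (B : ℕ) :
    (harmonic B : ℝ) = ∑ j ∈ range B, (((j : ℝ) + 1)⁻¹) := by
  induction B with
  | zero => simp
  | succ n ih =>
      rw [sum_range_succ, ← ih, harmonic_succ]
      push_cast
      ring

/-- **The `2π log` from below.** In the quadrant form of `sum_sum_inv_normSq_le`
(`μ_0 = 1`, `μ_k = 2`): `2π H(R) - 8 ≤ Σ_{(a,b) ∈ [0,R]², (a,b) ≠ 0} μ_a μ_b/(a² + b²)`, i.e.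
`Σ_{u ∈ ℤ², 0 < |u|_∞ ≤ R} |u|₂⁻² ≥ 2π H(R) - 8` — the lower half of Koma–Tasaki's P2 asymptotics
`Σ |∇φ|² ≈ (q²/π)·2π log` (the tree's `sum_sum_inv_normSq_le` is the upper half; row-by-row
arctangent count). [cite: KomaTasakiPRL1992, proof of eq. (13) (P2)] -/
theorem sum_sum_inv_normSq_ge (R : ℕ) :
    2 * Real.pi * (harmonic R : ℝ) - 8 ≤
      ∑ a ∈ range (R + 1), ∑ b ∈ range (R + 1),
        (if a = 0 ∧ b = 0 then (0:ℝ) else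
          (if a = 0 then (1:ℝ) else 2) * (if b = 0 then (1:ℝ) else 2) *
            (((a : ℝ) ^ 2 + (b : ℝ) ^ 2)⁻¹)) := by
  set F : ℕ → ℕ → ℝ := fun a b =>
    if a = 0 ∧ b = 0 then (0:ℝ) else
      (if a = 0 then (1:ℝ) else 2) * (if b = 0 then (1:ℝ) else 2) *
        (((a : ℝ) ^ 2 + (b : ℝ) ^ 2)⁻¹) with hF
  rw [sum_range_succ']
  -- the row `a = 0` is non-negative
  have hrow0 : 0 ≤ ∑ b ∈ range (R + 1), F 0 b := by
    refine sum_nonneg fun b _ => ?_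
    simp only [hF]
    split_ifs <;> positivity
  -- the rows `a = j + 1`
  have hrows : ∀ j : ℕ, j < R → 2 * (Real.pi / ((j:ℝ) + 1) - 2 / ((R:ℝ) + 1) - (((j:ℝ) + 1) ^ 2)⁻¹) ≤
      ∑ b ∈ range (R + 1), F (j + 1) b := by
    intro j _
    have h := row_sum_inv_normSq_ge (j + 1) R (by omega)
    have ht : ∀ b : ℕ, F (j + 1) b =
        2 * ((if b = 0 then (1:ℝ) else 2) * ((((j + 1 : ℕ) : ℝ)) ^ 2 + (b : ℝ) ^ 2)⁻¹) := by
      intro b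
      simp only [hF, Nat.succ_ne_zero, false_and, if_false]
      ring
    rw [sum_congr rfl fun b _ => ht b, ← mul_sum]
    push_cast at h ⊢
    linarith
  have hsum : ∑ j ∈ range R, 2 * (Real.pi / ((j:ℝ) + 1) - 2 / ((R:ℝ) + 1) - (((j:ℝ) + 1) ^ 2)⁻¹) ≤
      ∑ j ∈ range R, ∑ b ∈ range (R + 1), F (j + 1) b :=
    sum_le_sum fun j hj => hrows j (mem_range.1 hj)
  have hA : ∑ j ∈ range R, 2 * (Real.pi / ((j:ℝ) + 1)) = 2 * Real.pi * (harmonic R : ℝ) := by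
    rw [harmonic_eq_sum_range_inv_succ, mul_sum]
    exact sum_congr rfl fun j _ => by ring
  have hB : ∑ _j ∈ range R, 2 * (2 / ((R:ℝ) + 1)) = 4 * R / ((R:ℝ) + 1) := by
    rw [sum_const, card_range, nsmul_eq_mul]; ring
  have hC : ∑ j ∈ range R, 2 * ((((j : ℝ) + 1) ^ 2)⁻¹) = 2 * ∑ j ∈ range R, ((((j : ℝ) + 1) ^ 2)⁻¹) := by
    rw [mul_sum]
  have hev : ∑ j ∈ range R, 2 * (Real.pi / ((j:ℝ) + 1) - 2 / ((R:ℝ) + 1) - (((j:ℝ) + 1) ^ 2)⁻¹) =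
      2 * Real.pi * (harmonic R : ℝ) - 4 * R / ((R:ℝ) + 1) -
        2 * ∑ j ∈ range R, ((((j : ℝ) + 1) ^ 2)⁻¹) := by
    rw [← hA, ← hB, ← hC, ← sum_sub_distrib, ← sum_sub_distrib]
    exact sum_congr rfl fun j _ => by ring
  have h4 : 4 * (R : ℝ) / ((R:ℝ) + 1) ≤ 4 := by
    rw [div_le_iff₀ (by positivity)]; linarith
  have h2 := sum_inv_succ_sq_le_two R
  show 2 * Real.pi * (harmonic R : ℝ) - 8 ≤
    (∑ j ∈ range R, ∑ b ∈ range (R + 1), F (j + 1) b) + ∑ b ∈ range (R + 1), F 0 b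
  linarith [hsum, hev, h4, h2, hrow0]

/-! ### Lattice sums III: the three radial sums over the punctured box -/

/-- `Σ_{x ∈ Λ_R, x ≠ 0} |x|⁻² ≤ 2π H(R+1) + 8` (Koma–Tasaki P2, tree `sum_sum_inv_normSq_le`).
[cite: KomaTasakiPRL1992, proof of eq. (13) (P2)] -/
theorem sum_box_inv_normSq_le (R : ℕ) :
    ∑ x ∈ box R, (if x = 0 then 0 else (normSq x)⁻¹) ≤ 2 * Real.pi * (harmonic (R + 1) : ℝ) + 8 := by
  rw [sum_box_radial_eq R (fun t => t⁻¹)]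
  exact Literature.MathematicalPhysics.QuantumLattice.sum_sum_inv_normSq_le (R + 1)

/-- `Σ_{x ∈ Λ_R, x ≠ 0} |x|⁻² ≥ 2π H(R) - 8` (lower half of Koma–Tasaki's P2 asymptotics).
[cite: KomaTasakiPRL1992, proof of eq. (13) (P2)] -/
theorem sum_box_inv_normSq_ge (R : ℕ) :
    2 * Real.pi * (harmonic R : ℝ) - 8 ≤ ∑ x ∈ box R, (if x = 0 then 0 else (normSq x)⁻¹) := by
  rw [sum_box_radial_eq R (fun t => t⁻¹)]
  exact sum_sum_inv_normSq_ge R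

/-- `Σ_{x ∈ Λ_R, x ≠ 0} |x|⁻⁴ ≤ 68`, uniformly in `R` (from the tree's lattice-correction sum
`sum_sum_secondary_le`, since `1 ≤ a + b + 1`). [cite: KomaTasakiPRL1992, proof of eq. (13) (P2)] -/
theorem sum_box_inv_normSq_sq_le (R : ℕ) :
    ∑ x ∈ box R, (if x = 0 then 0 else ((normSq x) ^ 2)⁻¹) ≤ 68 := by
  rw [sum_box_radial_eq R (fun t => (t ^ 2)⁻¹)]
  refine le_trans (sum_le_sum fun a _ => sum_le_sum fun b _ => ?_)
    (Literature.MathematicalPhysics.QuantumLattice.sum_sum_secondary_le (R + 1))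
  by_cases h : a = 0 ∧ b = 0
  · rw [if_pos h, if_pos h]
  · rw [if_neg h, if_neg h]
    have hμ : (0:ℝ) ≤ (if a = 0 then (1:ℝ) else 2) * (if b = 0 then (1:ℝ) else 2) := by
      split_ifs <;> norm_num
    refine mul_le_mul_of_nonneg_left ?_ hμ
    have h1 : (1:ℝ) ≤ (a:ℝ) + b + 1 := by
      have : (0:ℝ) ≤ (a:ℝ) + b := by positivity
      linarith
    calc (((a:ℝ) ^ 2 + (b:ℝ) ^ 2) ^ 2)⁻¹ = 1 * (((a:ℝ) ^ 2 + (b:ℝ) ^ 2) ^ 2)⁻¹ := (one_mul _).symm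
      _ ≤ ((a:ℝ) + b + 1) * (((a:ℝ) ^ 2 + (b:ℝ) ^ 2) ^ 2)⁻¹ :=
          mul_le_mul_of_nonneg_right h1 (by positivity)

/-- `Σ_{x ∈ Λ_R, x ≠ 0} |x|⁻³ ≤ 68`, uniformly in `R` (again from `sum_sum_secondary_le`, since
`√(a² + b²) ≤ a + b + 1`). [cite: KomaTasakiPRL1992, proof of eq. (13) (P2)] -/
theorem sum_box_inv_normSq_mul_sqrt_le (R : ℕ) :
    ∑ x ∈ box R, (if x = 0 then 0 else (normSq x * Real.sqrt (normSq x))⁻¹) ≤ 68 := by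
  rw [sum_box_radial_eq R (fun t => (t * Real.sqrt t)⁻¹)]
  refine le_trans (sum_le_sum fun a _ => sum_le_sum fun b _ => ?_)
    (Literature.MathematicalPhysics.QuantumLattice.sum_sum_secondary_le (R + 1))
  by_cases h : a = 0 ∧ b = 0
  · rw [if_pos h, if_pos h]
  · rw [if_neg h, if_neg h]
    have hn : (0:ℝ) < (a:ℝ) ^ 2 + (b:ℝ) ^ 2 := by
      rcases not_and_or.1 h with ha | hb
      · have : (0:ℝ) < a := by exact_mod_cast Nat.pos_of_ne_zero ha
        positivity
      · have : (0:ℝ) < b := by exact_mod_cast Nat.pos_of_ne_zero hb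
        positivity
    have hμ : (0:ℝ) ≤ (if a = 0 then (1:ℝ) else 2) * (if b = 0 then (1:ℝ) else 2) := by
      split_ifs <;> norm_num
    refine mul_le_mul_of_nonneg_left ?_ hμ
    set n : ℝ := (a:ℝ) ^ 2 + (b:ℝ) ^ 2 with hn_def
    have hs : Real.sqrt n ≤ (a:ℝ) + b + 1 := by
      rw [Real.sqrt_le_left (by positivity)]
      have : (0:ℝ) ≤ (a:ℝ) * b := by positivity
      nlinarith
    have hs0 : 0 < Real.sqrt n := Real.sqrt_pos.2 hn
    rw [← div_eq_mul_inv, inv_eq_one_div, div_le_div_iff₀ (by positivity) (by positivity)]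
    have hsn : Real.sqrt n * Real.sqrt n = n := Real.mul_self_sqrt hn.le
    nlinarith [mul_le_mul_of_nonneg_left hs hn.le, hsn]

/-! ### The vortex energy from above: `E_R ≤ π H(R+1) + 80` -/

/-- Membership in the box. [folklore] -/
private theorem mem_box {R : ℕ} {x : ℤ × ℤ} :
    x ∈ box R ↔ -(R : ℤ) ≤ x.1 ∧ x.1 ≤ R ∧ -(R : ℤ) ≤ x.2 ∧ x.2 ≤ R := by
  simp [box, mem_product, mem_Icc, and_assoc]

/-- Re-indexing a sum over the far ends `x + v` of bonds inside the box by the end point: for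
`g ≥ 0`, `∑_{x ∈ Λ_R, x+v ∈ Λ_R, x+v ≠ 0} g(x+v) ≤ ∑_{y ∈ Λ_R, y ≠ 0} g(y)`. [folklore] -/
private theorem sum_shift_le (R : ℕ) (v : ℤ × ℤ) (g : ℤ × ℤ → ℝ) (hg : ∀ y, 0 ≤ g y) :
    ∑ x ∈ box R, (if x + v ∈ box R ∧ x + v ≠ 0 then g (x + v) else 0) ≤
      ∑ y ∈ box R, (if y = 0 then 0 else g y) := by
  classical
  rw [← sum_filter]
  have hinj : Set.InjOn (fun x : ℤ × ℤ => x + v)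
      ↑((box R).filter fun x => x + v ∈ box R ∧ x + v ≠ 0) := fun x _ y _ h => add_right_cancel h
  rw [← sum_image hinj]
  have hsub : ((box R).filter fun x => x + v ∈ box R ∧ x + v ≠ 0).image (fun x => x + v) ⊆
      (box R).filter fun y => y ≠ 0 := by
    intro y hy
    obtain ⟨x, hx, rfl⟩ := mem_image.1 hy
    exact mem_filter.2 (mem_filter.1 hx).2
  calc ∑ y ∈ ((box R).filter fun x => x + v ∈ box R ∧ x + v ≠ 0).image (fun x => x + v), g y
      ≤ ∑ y ∈ (box R).filter (fun y => y ≠ 0), g y :=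
        sum_le_sum_of_subset_of_nonneg hsub fun y _ _ => hg y
    _ = ∑ y ∈ box R, (if y = 0 then 0 else g y) := by
        rw [sum_filter]
        exact sum_congr rfl fun y _ => by split_ifs <;> simp_all

/-- At most two sites `x` of any set have `x = 0` or `x + v = 0`. [folklore] -/
private theorem sum_ite_core_le (R : ℕ) (v : ℤ × ℤ) :
    ∑ x ∈ box R, (if x = 0 ∨ x + v = 0 then (2:ℝ) else 0) ≤ 4 := by
  classical
  rw [← sum_filter, sum_const, nsmul_eq_mul]
  have hsub : ((box R).filter fun x => x = 0 ∨ x + v = 0) ⊆ {0, -v} := by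
    intro x hx
    rcases (mem_filter.1 hx).2 with h | h
    · simp [h]
    · simp [add_eq_zero_iff_eq_neg.1 h]
  have hcard : (((box R).filter fun x => x = 0 ∨ x + v = 0).card : ℝ) ≤ 2 := by
    have := (card_le_card hsub).trans (card_insert_le _ _)
    simp only [card_singleton] at this
    exact_mod_cast this
  linarith

/-- Pointwise majorant of the horizontal bond term of `E_R`. [folklore] -/
private theorem hBond_le (R : ℕ) (x : ℤ × ℤ) :
    (if x + (1, 0) ∈ box R then 1 - Real.cos (vortexPhase (x + (1, 0)) - vortexPhase x) else 0) ≤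
      (if x = 0 ∨ x + (1, 0) = 0 then (2:ℝ) else 0) +
        (if x = 0 then 0 else (x.2 : ℝ) ^ 2 / (4 * normSq x ^ 2)) +
        (if x + (1, 0) ∈ box R ∧ x + (1, 0) ≠ 0 then
          ((((x + (1, 0)).2 : ℤ) : ℝ) ^ 2 / (4 * normSq (x + (1, 0)) ^ 2) +
            1 / (2 * normSq (x + (1, 0)) ^ 2)) else 0) := by
  have hA : 0 ≤ (if x = 0 then 0 else (x.2 : ℝ) ^ 2 / (4 * normSq x ^ 2)) := by
    split_ifs <;> positivity
  have hC : 0 ≤ (if x + (1, 0) ∈ box R ∧ x + (1, 0) ≠ 0 then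
      ((((x + (1, 0)).2 : ℤ) : ℝ) ^ 2 / (4 * normSq (x + (1, 0)) ^ 2) +
        1 / (2 * normSq (x + (1, 0)) ^ 2)) else 0) := by
    split_ifs <;> positivity
  by_cases hB : x + (1, 0) ∈ box R
  · rw [if_pos hB]
    by_cases h0 : x = 0 ∨ x + (1, 0) = 0
    · rw [if_pos h0]
      linarith [(one_sub_cos_mem (vortexPhase (x + (1, 0)) - vortexPhase x)).2]
    · rw [if_neg h0]
      have hx : x ≠ 0 := fun h => h0 (Or.inl h)
      have hx' : x + (1, 0) ≠ 0 := fun h => h0 (Or.inr h)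
      rw [if_neg hx, if_pos ⟨hB, hx'⟩]
      have h := (vortex_bond_e1_bounds hx hx').2
      simp only [Prod.snd_add, add_zero] at h ⊢
      linarith
  · rw [if_neg hB]
    have : 0 ≤ (if x = 0 ∨ x + (1, 0) = 0 then (2:ℝ) else 0) := by split_ifs <;> norm_num
    linarith

/-- Pointwise majorant of the vertical bond term of `E_R`. [folklore] -/
private theorem vBond_le (R : ℕ) (x : ℤ × ℤ) :
    (if x + (0, 1) ∈ box R then 1 - Real.cos (vortexPhase (x + (0, 1)) - vortexPhase x) else 0) ≤
      (if x = 0 ∨ x + (0, 1) = 0 then (2:ℝ) else 0) +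
        (if x = 0 then 0 else (x.1 : ℝ) ^ 2 / (4 * normSq x ^ 2)) +
        (if x + (0, 1) ∈ box R ∧ x + (0, 1) ≠ 0 then
          ((((x + (0, 1)).1 : ℤ) : ℝ) ^ 2 / (4 * normSq (x + (0, 1)) ^ 2) +
            1 / (2 * normSq (x + (0, 1)) ^ 2)) else 0) := by
  have hA : 0 ≤ (if x = 0 then 0 else (x.1 : ℝ) ^ 2 / (4 * normSq x ^ 2)) := by
    split_ifs <;> positivity
  have hC : 0 ≤ (if x + (0, 1) ∈ box R ∧ x + (0, 1) ≠ 0 then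
      ((((x + (0, 1)).1 : ℤ) : ℝ) ^ 2 / (4 * normSq (x + (0, 1)) ^ 2) +
        1 / (2 * normSq (x + (0, 1)) ^ 2)) else 0) := by
    split_ifs <;> positivity
  by_cases hB : x + (0, 1) ∈ box R
  · rw [if_pos hB]
    by_cases h0 : x = 0 ∨ x + (0, 1) = 0
    · rw [if_pos h0]
      linarith [(one_sub_cos_mem (vortexPhase (x + (0, 1)) - vortexPhase x)).2]
    · rw [if_neg h0]
      have hx : x ≠ 0 := fun h => h0 (Or.inl h)
      have hx' : x + (0, 1) ≠ 0 := fun h => h0 (Or.inr h)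
      rw [if_neg hx, if_pos ⟨hB, hx'⟩]
      have h := (vortex_bond_e2_bounds hx hx').2
      simp only [Prod.fst_add, add_zero] at h ⊢
      linarith
  · rw [if_neg hB]
    have : 0 ≤ (if x = 0 ∨ x + (0, 1) = 0 then (2:ℝ) else 0) := by split_ifs <;> norm_num
    linarith

/-- **The vortex energy from above**: `E_R ≤ π H(R+1) + 80` for every `R` (`H` = harmonic numbers).
The coefficient `π` of the logarithm is Kosterlitz–Thouless' `π J ln(R/r₀)` (Herbut (6.5) with
`q = 1`); the constant absorbs the core energy and all lattice corrections.
[cite: Herbut2007CriticalPhenomena, §6.1 eq. (6.5)] -/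
theorem vortexEnergy_le_harmonic (R : ℕ) :
    vortexEnergy R ≤ Real.pi * (harmonic (R + 1) : ℝ) + 80 := by
  set B := box R with hB
  -- split the energy into horizontal and vertical bond sums and apply the pointwise majorants
  have hsplit : vortexEnergy R =
      (∑ x ∈ B, (if x + (1, 0) ∈ B then 1 - Real.cos (vortexPhase (x + (1, 0)) - vortexPhase x) else 0)) +
      ∑ x ∈ B, (if x + (0, 1) ∈ B then 1 - Real.cos (vortexPhase (x + (0, 1)) - vortexPhase x) else 0) := by
    rw [vortexEnergy, freeBoxEnergy, ← sum_add_distrib]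
  have hh : ∑ x ∈ B, (if x + (1, 0) ∈ B then 1 - Real.cos (vortexPhase (x + (1, 0)) - vortexPhase x) else 0)
      ≤ 4 + ∑ x ∈ B, (if x = 0 then 0 else (x.2 : ℝ) ^ 2 / (4 * normSq x ^ 2)) +
          ∑ y ∈ B, (if y = 0 then 0 else ((y.2 : ℝ) ^ 2 / (4 * normSq y ^ 2) + 1 / (2 * normSq y ^ 2))) := by
    have h1 := sum_le_sum fun x (_ : x ∈ B) => hBond_le R x
    rw [sum_add_distrib, sum_add_distrib] at h1
    have h2 := sum_ite_core_le R (1, 0)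
    have h3 := sum_shift_le R (1, 0)
      (fun y => (y.2 : ℝ) ^ 2 / (4 * normSq y ^ 2) + 1 / (2 * normSq y ^ 2)) fun y => by positivity
    linarith
  have hv : ∑ x ∈ B, (if x + (0, 1) ∈ B then 1 - Real.cos (vortexPhase (x + (0, 1)) - vortexPhase x) else 0)
      ≤ 4 + ∑ x ∈ B, (if x = 0 then 0 else (x.1 : ℝ) ^ 2 / (4 * normSq x ^ 2)) +
          ∑ y ∈ B, (if y = 0 then 0 else ((y.1 : ℝ) ^ 2 / (4 * normSq y ^ 2) + 1 / (2 * normSq y ^ 2))) := by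
    have h1 := sum_le_sum fun x (_ : x ∈ B) => vBond_le R x
    rw [sum_add_distrib, sum_add_distrib] at h1
    have h2 := sum_ite_core_le R (0, 1)
    have h3 := sum_shift_le R (0, 1)
      (fun y => (y.1 : ℝ) ^ 2 / (4 * normSq y ^ 2) + 1 / (2 * normSq y ^ 2)) fun y => by positivity
    linarith
  -- the four radial sums combine to `½ Σ |x|⁻² + Σ |x|⁻⁴`
  have hcomb : ∑ x ∈ B, (if x = 0 then 0 else (x.2 : ℝ) ^ 2 / (4 * normSq x ^ 2)) +
      ∑ y ∈ B, (if y = 0 then 0 else ((y.2 : ℝ) ^ 2 / (4 * normSq y ^ 2) + 1 / (2 * normSq y ^ 2))) +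
      (∑ x ∈ B, (if x = 0 then 0 else (x.1 : ℝ) ^ 2 / (4 * normSq x ^ 2)) +
      ∑ y ∈ B, (if y = 0 then 0 else ((y.1 : ℝ) ^ 2 / (4 * normSq y ^ 2) + 1 / (2 * normSq y ^ 2)))) =
      (1/2) * ∑ x ∈ B, (if x = 0 then 0 else (normSq x)⁻¹) +
        ∑ x ∈ B, (if x = 0 then 0 else ((normSq x) ^ 2)⁻¹) := by
    rw [mul_sum, ← sum_add_distrib, ← sum_add_distrib, ← sum_add_distrib, ← sum_add_distrib]
    refine sum_congr rfl fun x _ => ?_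
    split_ifs with hx
    · simp
    · have hn : normSq x ≠ 0 := (normSq_pos hx).ne'
      have hdef : normSq x = (x.1 : ℝ) ^ 2 + (x.2 : ℝ) ^ 2 := rfl
      field_simp
      rw [hdef]
      ring
  have hS1 := sum_box_inv_normSq_le R
  have hS2 := sum_box_inv_normSq_sq_le R
  rw [hsplit]
  have hpi : 0 < Real.pi := Real.pi_pos
  nlinarith [hh, hv, hcomb, hS1, hS2]

/-! ### The vortex energy from below: `E_R ≥ π H(R) - 74` -/

/-- The sites of the box with a prescribed first coordinate number `2R+1`. [folklore] -/
private theorem card_box_filter_fst (R : ℕ) (c : ℤ) :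
    ((box R).filter fun x => x.1 = c).card ≤ 2 * R + 1 := by
  classical
  have hsub : ((box R).filter fun x => x.1 = c) ⊆ ({c} : Finset ℤ) ×ˢ Icc (-(R : ℤ)) R := by
    intro x hx
    rw [mem_filter, mem_box] at hx
    simp only [mem_product, mem_singleton, mem_Icc]
    exact ⟨hx.2, hx.1.2.2.1, hx.1.2.2.2⟩
  refine (card_le_card hsub).trans ?_
  rw [card_product, card_singleton, Int.card_Icc]
  omega

/-- The sites of the box with a prescribed second coordinate number `2R+1`. [folklore] -/
private theorem card_box_filter_snd (R : ℕ) (c : ℤ) :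
    ((box R).filter fun x => x.2 = c).card ≤ 2 * R + 1 := by
  classical
  have hsub : ((box R).filter fun x => x.2 = c) ⊆ Icc (-(R : ℤ)) R ×ˢ ({c} : Finset ℤ) := by
    intro x hx
    rw [mem_filter, mem_box] at hx
    simp only [mem_product, mem_singleton, mem_Icc]
    exact ⟨⟨hx.1.1, hx.1.2.1⟩, hx.2⟩
  refine (card_le_card hsub).trans ?_
  rw [card_product, card_singleton, Int.card_Icc]
  omega

/-- The boundary deficit: `∑_{x ∈ Λ_R, x₁ = c} 1/(2(R+1)²) ≤ 1`. [folklore] -/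
private theorem sum_boundary_fst_le (R : ℕ) (c : ℤ) :
    ∑ x ∈ box R, (if x.1 = c then 1 / (2 * ((R : ℝ) + 1) ^ 2) else 0) ≤ 1 := by
  classical
  rw [← sum_filter, sum_const, nsmul_eq_mul]
  have hc : (((box R).filter fun x => x.1 = c).card : ℝ) ≤ 2 * R + 1 := by
    exact_mod_cast card_box_filter_fst R c
  have hR : (0 : ℝ) ≤ R := Nat.cast_nonneg R
  rw [← div_eq_mul_one_div, div_le_one (by positivity)]
  nlinarith

/-- The boundary deficit: `∑_{x ∈ Λ_R, x₂ = c} 1/(2(R+1)²) ≤ 1`. [folklore] -/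
private theorem sum_boundary_snd_le (R : ℕ) (c : ℤ) :
    ∑ x ∈ box R, (if x.2 = c then 1 / (2 * ((R : ℝ) + 1) ^ 2) else 0) ≤ 1 := by
  classical
  rw [← sum_filter, sum_const, nsmul_eq_mul]
  have hc : (((box R).filter fun x => x.2 = c).card : ℝ) ≤ 2 * R + 1 := by
    exact_mod_cast card_box_filter_snd R c
  have hR : (0 : ℝ) ≤ R := Nat.cast_nonneg R
  rw [← div_eq_mul_one_div, div_le_one (by positivity)]
  nlinarith

/-- On the far column the main term is small: if `|x₁| = R` then
`β/(2n(√n+1)²) ≤ 1/(2(R+1)²)` for `β ≤ n = |x|²`. [folklore] -/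
private theorem main_term_le_of_coord {R : ℕ} {x : ℤ × ℤ} {β : ℝ} (hx : x ≠ 0)
    (hβn : β ≤ normSq x) (hR : (R : ℝ) ≤ Real.sqrt (normSq x)) :
    β / (2 * normSq x * (Real.sqrt (normSq x) + 1) ^ 2) ≤ 1 / (2 * ((R : ℝ) + 1) ^ 2) := by
  have hn := normSq_pos hx
  have hs : 0 ≤ Real.sqrt (normSq x) := Real.sqrt_nonneg _
  rw [div_le_div_iff₀ (by positivity) (by positivity)]
  have h1 : ((R : ℝ) + 1) ^ 2 ≤ (Real.sqrt (normSq x) + 1) ^ 2 := by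
    apply pow_le_pow_left₀ (by positivity); linarith
  calc β * (2 * ((R : ℝ) + 1) ^ 2) ≤ normSq x * (2 * (Real.sqrt (normSq x) + 1) ^ 2) := by
        gcongr
    _ = 1 * (2 * normSq x * (Real.sqrt (normSq x) + 1) ^ 2) := by ring

/-- Pointwise minorant of the horizontal bond term of `E_R` (the boundary column `x₁ = R` and the
core bonds excepted). [folklore] -/
private theorem le_hBond (R : ℕ) {x : ℤ × ℤ} (hxB : x ∈ box R) :
    (if x = 0 then 0 else (x.2 : ℝ) ^ 2 / (2 * normSq x * (Real.sqrt (normSq x) + 1) ^ 2)) ≤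
      (if x + (1, 0) ∈ box R then 1 - Real.cos (vortexPhase (x + (1, 0)) - vortexPhase x) else 0) +
        (if x.1 = R then 1 / (2 * ((R : ℝ) + 1) ^ 2) else 0) := by
  have hE : 0 ≤ (if x + (1, 0) ∈ box R then
      1 - Real.cos (vortexPhase (x + (1, 0)) - vortexPhase x) else 0) := by
    split_ifs
    · exact (one_sub_cos_mem _).1
    · exact le_rfl
  have hD : 0 ≤ (if x.1 = R then 1 / (2 * ((R : ℝ) + 1) ^ 2) else 0) := by
    split_ifs <;> positivity
  by_cases hx : x = 0
  · rw [if_pos hx]; linarith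
  rw [if_neg hx]
  by_cases hB : x + (1, 0) ∈ box R
  · by_cases hx' : x + (1, 0) = 0
    · -- the core bond `(-1,0) → 0`: `x₂ = 0`
      have h2 : x.2 = 0 := by
        have := congrArg Prod.snd hx'
        simpa using this
      have hz : ((x.2 : ℤ) : ℝ) ^ 2 / (2 * normSq x * (Real.sqrt (normSq x) + 1) ^ 2) = 0 := by
        rw [h2]; simp
      rw [hz]; linarith
    · rw [if_pos hB]
      linarith [(vortex_bond_e1_bounds hx hx').1]
  · -- `x + e₁ ∉ Λ_R` forces `x₁ = R`
    have h1 : x.1 = R := by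
      rw [mem_box] at hxB hB
      simp only [Prod.fst_add, Prod.snd_add, add_zero] at hB
      omega
    rw [if_neg hB, if_pos h1, zero_add]
    refine main_term_le_of_coord hx ?_ ?_
    · simp only [normSq]; nlinarith [sq_nonneg (x.1 : ℝ)]
    · have := fst_le_sqrt_normSq x
      have h1' : ((x.1 : ℤ) : ℝ) = (R : ℝ) := by rw [h1]; simp
      linarith

/-- Pointwise minorant of the vertical bond term of `E_R`. [folklore] -/
private theorem le_vBond (R : ℕ) {x : ℤ × ℤ} (hxB : x ∈ box R) :
    (if x = 0 then 0 else (x.1 : ℝ) ^ 2 / (2 * normSq x * (Real.sqrt (normSq x) + 1) ^ 2)) ≤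
      (if x + (0, 1) ∈ box R then 1 - Real.cos (vortexPhase (x + (0, 1)) - vortexPhase x) else 0) +
        (if x.2 = R then 1 / (2 * ((R : ℝ) + 1) ^ 2) else 0) := by
  have hE : 0 ≤ (if x + (0, 1) ∈ box R then
      1 - Real.cos (vortexPhase (x + (0, 1)) - vortexPhase x) else 0) := by
    split_ifs
    · exact (one_sub_cos_mem _).1
    · exact le_rfl
  have hD : 0 ≤ (if x.2 = R then 1 / (2 * ((R : ℝ) + 1) ^ 2) else 0) := by
    split_ifs <;> positivity
  by_cases hx : x = 0
  · rw [if_pos hx]; linarith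
  rw [if_neg hx]
  by_cases hB : x + (0, 1) ∈ box R
  · by_cases hx' : x + (0, 1) = 0
    · have h2 : x.1 = 0 := by
        have := congrArg Prod.fst hx'
        simpa using this
      have hz : ((x.1 : ℤ) : ℝ) ^ 2 / (2 * normSq x * (Real.sqrt (normSq x) + 1) ^ 2) = 0 := by
        rw [h2]; simp
      rw [hz]; linarith
    · rw [if_pos hB]
      linarith [(vortex_bond_e2_bounds hx hx').1]
  · have h1 : x.2 = R := by
      rw [mem_box] at hxB hB
      simp only [Prod.fst_add, Prod.snd_add, add_zero] at hB
      omega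
    rw [if_neg hB, if_pos h1, zero_add]
    refine main_term_le_of_coord hx ?_ ?_
    · simp only [normSq]; nlinarith [sq_nonneg (x.2 : ℝ)]
    · have := snd_le_sqrt_normSq x
      have h1' : ((x.2 : ℤ) : ℝ) = (R : ℝ) := by rw [h1]; simp
      linarith

/-- The per-site main term dominates `1/(2n) - 1/(n√n)`: for `n ≥ 1`,
`(2n)⁻¹ - (n√n)⁻¹ ≤ (2(√n+1)²)⁻¹` (i.e. `(s-2)(s+1)² ≤ s³`, `s = √n`). [folklore] -/
private theorem inv_two_mul_sub_le {n : ℝ} (hn : 1 ≤ n) :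
    (2 * n)⁻¹ - (n * Real.sqrt n)⁻¹ ≤ 1 / (2 * (Real.sqrt n + 1) ^ 2) := by
  set s := Real.sqrt n with hs
  have hs1 : 1 ≤ s := by rw [hs]; exact Real.one_le_sqrt.2 hn
  have hs0 : 0 < s := by linarith
  have hn' : s ^ 2 = n := by rw [hs]; exact Real.sq_sqrt (by linarith)
  rw [← hn']
  rw [show (2 * s ^ 2)⁻¹ - (s ^ 2 * s)⁻¹ = (s - 2) / (2 * s ^ 3) by field_simp]
  rw [div_le_div_iff₀ (by positivity) (by positivity)]
  nlinarith [pow_pos hs0 3, hs1]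

/-- **The vortex energy from below**: `π H(R) - 74 ≤ E_R` for every `R`.
[cite: Herbut2007CriticalPhenomena, §6.1 eq. (6.5)] -/
theorem harmonic_le_vortexEnergy (R : ℕ) :
    Real.pi * (harmonic R : ℝ) - 74 ≤ vortexEnergy R := by
  set B := box R with hB
  have hsplit : vortexEnergy R =
      (∑ x ∈ B, (if x + (1, 0) ∈ B then 1 - Real.cos (vortexPhase (x + (1, 0)) - vortexPhase x) else 0)) +
      ∑ x ∈ B, (if x + (0, 1) ∈ B then 1 - Real.cos (vortexPhase (x + (0, 1)) - vortexPhase x) else 0) := by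
    rw [vortexEnergy, freeBoxEnergy, ← sum_add_distrib]
  have hh : ∑ x ∈ B, (if x = 0 then 0 else (x.2 : ℝ) ^ 2 / (2 * normSq x * (Real.sqrt (normSq x) + 1) ^ 2))
      ≤ (∑ x ∈ B, (if x + (1, 0) ∈ B then 1 - Real.cos (vortexPhase (x + (1, 0)) - vortexPhase x) else 0))
        + 1 := by
    have h1 := sum_le_sum fun x (hx : x ∈ B) => le_hBond R hx
    rw [sum_add_distrib] at h1
    linarith [sum_boundary_fst_le R R]
  have hv : ∑ x ∈ B, (if x = 0 then 0 else (x.1 : ℝ) ^ 2 / (2 * normSq x * (Real.sqrt (normSq x) + 1) ^ 2))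
      ≤ (∑ x ∈ B, (if x + (0, 1) ∈ B then 1 - Real.cos (vortexPhase (x + (0, 1)) - vortexPhase x) else 0))
        + 1 := by
    have h1 := sum_le_sum fun x (hx : x ∈ B) => le_vBond R hx
    rw [sum_add_distrib] at h1
    linarith [sum_boundary_snd_le R R]
  -- the two main terms combine to `Σ 1/(2(√n+1)²) ≥ ½ Σ |x|⁻² - Σ |x|⁻³`
  have hcomb : (1/2) * ∑ x ∈ B, (if x = 0 then 0 else (normSq x)⁻¹) -
      ∑ x ∈ B, (if x = 0 then 0 else (normSq x * Real.sqrt (normSq x))⁻¹) ≤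
      ∑ x ∈ B, (if x = 0 then 0 else (x.2 : ℝ) ^ 2 / (2 * normSq x * (Real.sqrt (normSq x) + 1) ^ 2)) +
      ∑ x ∈ B, (if x = 0 then 0 else (x.1 : ℝ) ^ 2 / (2 * normSq x * (Real.sqrt (normSq x) + 1) ^ 2)) := by
    rw [mul_sum, ← sum_sub_distrib, ← sum_add_distrib]
    refine sum_le_sum fun x _ => ?_
    split_ifs with hx
    · simp
    · have hn1 := one_le_normSq hx
      have hn : normSq x ≠ 0 := (normSq_pos hx).ne'
      have hdef : normSq x = (x.1 : ℝ) ^ 2 + (x.2 : ℝ) ^ 2 := rfl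
      have key := inv_two_mul_sub_le hn1
      have hsum : (x.2 : ℝ) ^ 2 / (2 * normSq x * (Real.sqrt (normSq x) + 1) ^ 2) +
          (x.1 : ℝ) ^ 2 / (2 * normSq x * (Real.sqrt (normSq x) + 1) ^ 2) =
          1 / (2 * (Real.sqrt (normSq x) + 1) ^ 2) := by
        rw [← add_div, show (x.2 : ℝ) ^ 2 + (x.1 : ℝ) ^ 2 = normSq x by rw [hdef]; ring]
        field_simp
      rw [hsum]
      rw [mul_inv] at key
      linarith
  have hS1 := sum_box_inv_normSq_ge R
  have hS3 := sum_box_inv_normSq_mul_sqrt_le R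
  rw [hsplit]
  nlinarith [hh, hv, hcomb, hS1, hS3, Real.pi_pos]

/-! ### The vortex energy is `π log R + O(1)`, two-sided -/

/-- **Upper bound, logarithmic form**: `E_R ≤ π log R + 88` (every `R`; `log 0 = 0`).
[cite: Herbut2007CriticalPhenomena, §6.1 eq. (6.5)] -/
theorem vortexEnergy_le_log (R : ℕ) :
    vortexEnergy R ≤ Real.pi * Real.log R + 88 := by
  have h := vortexEnergy_le_harmonic R
  have hH : (harmonic (R + 1) : ℝ) ≤ 2 + Real.log R := by
    have h1 := harmonic_le_one_add_log R
    have h2 : (harmonic (R + 1) : ℝ) = harmonic R + (((R : ℝ) + 1))⁻¹ := by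
      rw [harmonic_succ]; push_cast; ring
    have h3 : (((R : ℝ) + 1))⁻¹ ≤ 1 := by
      apply inv_le_one_of_one_le₀; have : (0:ℝ) ≤ R := Nat.cast_nonneg R; linarith
    linarith
  have hpi := Real.pi_le_four
  have hlog : 0 ≤ Real.log R := Real.log_natCast_nonneg R
  nlinarith [Real.pi_pos]

/-- **Lower bound, logarithmic form**: `π log R - 74 ≤ E_R` (every `R`; `log 0 = 0`).
[cite: Herbut2007CriticalPhenomena, §6.1 eq. (6.5)] -/
theorem log_le_vortexEnergy (R : ℕ) :
    Real.pi * Real.log R - 74 ≤ vortexEnergy R := by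
  have h := harmonic_le_vortexEnergy R
  have hH : Real.log R ≤ (harmonic R : ℝ) := by
    rcases Nat.eq_zero_or_pos R with rfl | hR
    · simp
    · have h1 := log_add_one_le_harmonic R
      have h2 : Real.log R ≤ Real.log ((R + 1 : ℕ) : ℝ) :=
        Real.log_le_log (by exact_mod_cast hR) (by push_cast; linarith)
      linarith
  nlinarith [Real.pi_pos]

/-- **The Kosterlitz–Thouless vortex energy, lattice-exact**: `|E_R - π log R| ≤ 88` for
every `R` — the energy of the unit vortex in `Λ_R = [-R, R]²` is `π J log R` up to a bounded core and
lattice correction, with the coefficient `π` exact (no continuum approximation, no `ε`).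
Kosterlitz–Thouless 1973; Herbut 2007 §6.1 (6.5) `H_v = π q² Φ₀² ln(R/r₀)`.
[cite: Herbut2007CriticalPhenomena, §6.1 eq. (6.5)] -/
theorem abs_vortexEnergy_sub_pi_mul_log_le (R : ℕ) :
    |vortexEnergy R - Real.pi * Real.log R| ≤ 88 := by
  rw [abs_le]
  constructor
  · linarith [log_le_vortexEnergy R]
  · linarith [vortexEnergy_le_log R]

/-- `E_R / log R → π`: the vortex energy grows like `π log R`. [cite: Herbut2007CriticalPhenomena, §6.1 eq. (6.5)] -/
theorem tendsto_vortexEnergy_div_log :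
    Tendsto (fun R : ℕ => vortexEnergy R / Real.log R) atTop (𝓝 Real.pi) := by
  have hlog : Tendsto (fun R : ℕ => Real.log (R : ℝ)) atTop atTop :=
    Real.tendsto_log_atTop.comp tendsto_natCast_atTop_atTop
  have hC : Tendsto (fun R : ℕ => (88 : ℝ) / Real.log R) atTop (𝓝 0) :=
    tendsto_const_nhds.div_atTop hlog
  have hlo : Tendsto (fun R : ℕ => Real.pi - 88 / Real.log R) atTop (𝓝 Real.pi) := by
    simpa using tendsto_const_nhds.sub hC
  have hhi : Tendsto (fun R : ℕ => Real.pi + 88 / Real.log R) atTop (𝓝 Real.pi) := by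
    simpa using tendsto_const_nhds.add hC
  refine tendsto_of_tendsto_of_tendsto_of_le_of_le' hlo hhi ?_ ?_
  · filter_upwards [eventually_ge_atTop 2] with R hR
    have hl : 0 < Real.log R := Real.log_pos (by exact_mod_cast hR)
    have h := log_le_vortexEnergy R
    have e : (Real.pi - 88 / Real.log ↑R) * Real.log ↑R = Real.pi * Real.log R - 88 := by
      field_simp
    rw [le_div_iff₀ hl, e]
    linarith
  · filter_upwards [eventually_ge_atTop 2] with R hR
    have hl : 0 < Real.log R := Real.log_pos (by exact_mod_cast hR)
    have h := vortexEnergy_le_log R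
    have e : (Real.pi + 88 / Real.log ↑R) * Real.log ↑R = Real.pi * Real.log R + 88 := by
      field_simp
    rw [div_le_iff₀ hl, e]
    linarith

/-! ### The positional entropy: `#Λ_R = (2R+1)²` -/

/-- `#Λ_R = (2R+1)²`: the number of positions of the vortex core ("the center of a vortex may be
placed at any of `∼ (R/r₀)²` sites", Herbut §6.1 before (6.6)).
[cite: Herbut2007CriticalPhenomena, §6.1 eq. (6.6)] -/
theorem card_box (R : ℕ) : (box R).card = (2 * R + 1) ^ 2 := by
  rw [box, card_product, Int.card_Icc]
  have h : ((R : ℤ) + 1 - -(R : ℤ)).toNat = 2 * R + 1 := by omega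
  rw [h, sq]

/-- The positional entropy `log #Λ_R = 2 log(2R+1)` (`ΔS_v = ln (R/r₀)²`, Herbut §6.1).
[cite: Herbut2007CriticalPhenomena, §6.1 eq. (6.6)] -/
theorem log_card_box (R : ℕ) : Real.log ((box R).card : ℝ) = 2 * Real.log (2 * (R : ℝ) + 1) := by
  rw [card_box]; push_cast
  rw [Real.log_pow]; norm_num

/-- `log #Λ_R / log R → 2`: the entropy of one free vortex grows like `2 log R` (two dimensions).
[cite: Herbut2007CriticalPhenomena, §6.1 eq. (6.7)] -/
theorem tendsto_log_card_box_div_log :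
    Tendsto (fun R : ℕ => Real.log ((box R).card : ℝ) / Real.log R) atTop (𝓝 2) := by
  have hlog : Tendsto (fun R : ℕ => Real.log (R : ℝ)) atTop atTop :=
    Real.tendsto_log_atTop.comp tendsto_natCast_atTop_atTop
  have hC : Tendsto (fun R : ℕ => (2 * Real.log 3 : ℝ) / Real.log R) atTop (𝓝 0) :=
    tendsto_const_nhds.div_atTop hlog
  have hhi : Tendsto (fun R : ℕ => 2 + 2 * Real.log 3 / Real.log R) atTop (𝓝 2) := by
    simpa using tendsto_const_nhds.add hC
  refine tendsto_of_tendsto_of_tendsto_of_le_of_le' tendsto_const_nhds hhi ?_ ?_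
  · filter_upwards [eventually_ge_atTop 2] with R hR
    have hR' : (2 : ℝ) ≤ R := by exact_mod_cast hR
    have hl : 0 < Real.log R := Real.log_pos (by linarith)
    rw [log_card_box, le_div_iff₀ hl]
    have : Real.log R ≤ Real.log (2 * (R : ℝ) + 1) := Real.log_le_log (by linarith) (by linarith)
    linarith
  · filter_upwards [eventually_ge_atTop 2] with R hR
    have hR' : (2 : ℝ) ≤ R := by exact_mod_cast hR
    have hl : 0 < Real.log R := Real.log_pos (by linarith)
    rw [log_card_box, div_le_iff₀ hl]
    have h3 : Real.log (2 * (R : ℝ) + 1) ≤ Real.log 3 + Real.log R := by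
      rw [← Real.log_mul (by norm_num) (by linarith)]
      exact Real.log_le_log (by linarith) (by linarith)
    have : (2 + 2 * Real.log 3 / Real.log ↑R) * Real.log ↑R = 2 * Real.log R + 2 * Real.log 3 := by
      field_simp
    linarith [this]

/-! ### The free energy of one free vortex and the Kosterlitz–Thouless threshold `T = (π/2) J` -/

/-- **Kosterlitz–Thouless, lattice-exact**: `F_R(T)/log R → π J - 2 T`. The free energy of a single
free vortex in `Λ_R` is `(π J - 2T) log R + O(1)`: energy `π J log R` against entropy `2 T log R`.
[cite: Herbut2007CriticalPhenomena, §6.1 eq. (6.6)] -/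
theorem tendsto_vortexFreeEnergy_div_log (J T : ℝ) :
    Tendsto (fun R : ℕ => vortexFreeEnergy J T R / Real.log R) atTop
      (𝓝 (Real.pi * J - 2 * T)) := by
  have h := ((tendsto_vortexEnergy_div_log.const_mul J).sub
    (tendsto_log_card_box_div_log.const_mul T))
  have hlim : J * Real.pi - T * 2 = Real.pi * J - 2 * T := by ring
  rw [hlim] at h
  refine h.congr fun R => ?_
  simp only [vortexFreeEnergy]
  ring

/-- **Above `(π/2) J` free vortices proliferate**: if `T > (π/2) J` the single-vortex free energy is
eventually NEGATIVE (`F_R(T) < 0` for all large boxes) — the entropy `2T log R` beats the energy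
`π J log R`. Kosterlitz–Thouless 1973; Herbut 2007 §6.1 (6.6)–(6.7) (`ΔF` changes sign at
`T_KT = π Φ₀²/2`). [cite: Herbut2007CriticalPhenomena, §6.1 eq. (6.7)] -/
theorem vortexFreeEnergy_eventually_neg {J T : ℝ} (hT : Real.pi / 2 * J < T) :
    ∀ᶠ R : ℕ in atTop, vortexFreeEnergy J T R < 0 := by
  have hL : Real.pi * J - 2 * T < 0 := by linarith
  have h1 : ∀ᶠ R : ℕ in atTop, vortexFreeEnergy J T R / Real.log R < 0 :=
    (tendsto_vortexFreeEnergy_div_log J T).eventually (gt_mem_nhds hL)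
  filter_upwards [h1, eventually_ge_atTop 2] with R hF hR
  have hl : 0 < Real.log R := Real.log_pos (by exact_mod_cast hR)
  have := (div_lt_iff₀ hl).1 hF
  simpa using this

/-- **Below `(π/2) J` a free vortex is suppressed**: if `T < (π/2) J` the single-vortex free energy is
eventually POSITIVE (`F_R(T) > 0` for all large boxes). Together with the previous theorem: the
Kosterlitz–Thouless energy–entropy threshold of the plane-rotator comparison model is EXACTLY
`T = (π/2) J` — the Nelson–Kosterlitz constant (`= (π/4) ρ_s` in the units `J = ρ_s/2`).
[cite: Herbut2007CriticalPhenomena, §6.1 eq. (6.7)] -/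
theorem vortexFreeEnergy_eventually_pos {J T : ℝ} (hT : T < Real.pi / 2 * J) :
    ∀ᶠ R : ℕ in atTop, 0 < vortexFreeEnergy J T R := by
  have hL : 0 < Real.pi * J - 2 * T := by linarith
  have h1 : ∀ᶠ R : ℕ in atTop, 0 < vortexFreeEnergy J T R / Real.log R :=
    (tendsto_vortexFreeEnergy_div_log J T).eventually (lt_mem_nhds hL)
  filter_upwards [h1, eventually_ge_atTop 2] with R hF hR
  have hl : 0 < Real.log R := Real.log_pos (by exact_mod_cast hR)
  have := (lt_div_iff₀ hl).1 hF
  simpa using this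

/-- The threshold itself: the slope `π J - 2 T` of `F_R(T)` against `log R` vanishes exactly at
`T = (π/2) J`, and is negative (positive) above (below). [cite: Herbut2007CriticalPhenomena, §6.1 eq. (6.7)] -/
theorem vortexFreeEnergy_slope_eq_zero_iff (J T : ℝ) :
    Real.pi * J - 2 * T = 0 ↔ T = Real.pi / 2 * J := by
  constructor <;> intro h <;> linarith

end PlaneRotator

end Literature.Probability.LatticeModels
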